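import Summits.HodgeConjecture.HodgeConjecture.Theorems.HodgeLocusCensusUnitColumnRankDropExact

/-!
# Hodge locus census — the middle term: the modular Betti number of the inclusion ladder, and the three-case law of a block (PROBE 28)

certified instances and evidence bearing on the general Hodge conjecture; no claim.  Theorem-only helper sheet of the
unit-column / inclusion-matrix line (anchors InclusionRankComplement, InclusionRankLift, InclusionRankFiltration,
UnitColumnRankDrop (304), …, UnitColumnRankDropExact (PROBE 27)); nothing here is a statement about Hodge loci.

WHAT.  Fix a prime `p`, `0 < c < p`, a finite type `α` with `#α = m` and the inclusion matrices
`W_{a,b} = Matrix.of fun (S : {S // S.card = a}) (U : {U // U.card = b}) => if S ⊆ U then 1 else 0` over a field `K` of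
characteristic `p`.  The ladder `⋯ → K^{(T−(p−c))-sets} → K^{T-sets} → K^{(T+c)-sets} → ⋯` (row vectors times `W`) is a complex,
`W_{T−(p−c),T} · W_{T,T+c} = C(p, p−c) · W_{T−(p−c),T+c} = 0` (§2 (B-cx), anchor InclusionRankFiltration `incl_mul_incl`).  PROBE 27 proved it
EXACT at `K^{T-sets}` whenever the outgoing arrow is balanced (`2T + c ≤ m`).  This sheet computes the homology at the FIRST unbalanced
spot, i.e. for `T` in the closed window `2T ≤ m + (p − c)` (incoming arrow balanced) and `m ≤ 2T + c`, with `p − c ≤ T`, `T + c ≤ m`: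

  (B-hom)  `dim leftker W_{T,T+c} − rank W_{T−(p−c),T} = S_p(m, T) − S_p(m, T + c)`,  `S_p(m, x) := Σ_{0 ≤ y ≤ m, y ≡ x (mod p)} C(m, y)`,

a DIFFERENCE OF TWO `p`-SECTIONS OF THE BINOMIAL ROW (for `p = 2` it is `0`, for `p = 3` it is `0` or `1`, for `p = 5` a Fibonacci number).
The sections are written in pieces, `S_p(m, x) = Σ_{b < x/p} C(m, x − (b+1)p) + C(m, x) + Σ_{b < (m−x)/p} C(m, x + (b+1)p)` (`x ≤ m`), so
that every statement is over `ℕ` with the tree's Wilson-sum shape and closes by `omega`: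
* §1 (B-W) the arithmetic identity: the two Wilson sums (anchor InclusionRankLift's shape) at `(m−(T+c) → m−T)` and at `(T−(p−c) → T)`
  plus the outer pieces of `S_p(m,T)` equal the three pieces of `S_p(m,T+c)` — from anchor 304's (FY) `wilson_sum_add_eq` twice, the
  symmetry `C(m, m−y) = C(m, y)` and one index shift; hypotheses `T + c ≤ m`, `p − c ≤ T`, `2(T−(p−c)) ≤ m`, `2(m−(T+c)) ≤ m`.
* §2 (B-rank) `rank W_{T,T+c} + rank W_{T−(p−c),T} + (outer pieces of S_p(m,T)) = (pieces of S_p(m,T+c))` in the window (anchor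
  InclusionRankComplement `rank_incl_eq_rank_incl_compl` moves the unbalanced block to its balanced complement `W_{m−T−c,m−T}`, anchor
  InclusionRankLift `rank_incl_eq_sum` evaluates both ranks, then (B-W)); (B-cx) the complex property; (B-hom) the homology dimension by
  rank–nullity.
* §3 (BLOCK LAW) the THREE-CASE LAW of one block, for EVERY `m, t` and with no hypothesis beyond `p` prime, `0 < c < p`: with `OUT`, `IN` the
  three-branch block values of anchor UnitColumnRankLevelsWilson (294) — `0` if the block has no columns, Wilson's sum below the middle, the
  complement's Wilson sum above it — of `(t → t+c)` and of `(t−(p−c) → t)` (`0` if `t < p−c`), and the WINDOW `2t ≤ m + (p−c) ∧ m < 2t + c`: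
  `OUT + IN + [window]·S_p(m,t) = C(m,t) + [window]·S_p(m,t+c)` over `ℕ` — below the window this is PROBE 27 (EX-W), beyond it (EX-W) with
  `(c, p−c)` exchanged at the complement block, inside it (B-W) and its degenerate corners `t < p−c` / `m < t+c` (anchor 304 (FY) directly);
  seven cases glued by the re-indexings `sum_choose_reflect` (`C(m,m−y) = C(m,y)`) and `sum_choose_shift`, each closed by `omega`.  It is the
  form in which the law is summed over anchor 294's labels (PROBE 29: the census Betti number at every codegree).

WHERE IT STANDS (context only; nothing imported or minted).  This is, for the trivial group and dualised to the superset direction,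
Theorem 5.3 of V. B. Mnukhin & J. Siemons, «The modular homology of inclusion maps and group actions», J. Combin. Theory Ser. A 74
(1996) 287–300, doi:10.1006/jcta.1996.0051: an `(r, q)`-sequence is `p`-exact everywhere except possibly at `O_{q*−p} ← O_{r*} ← O_{q*}`,
`r* < q*` least with `r* + q* > |Ω|`, where `β = Σ_k n_{r*+kp} − n_{q*+kp}` (`n_j = C(|Ω|, j)` for `G = 1`; here `r* = T`, `q* = T + c`).
The sheet re-proves that value in a few lines from Wilson's rank formula as formalised in the tree; no literature fact is used as a
hypothesis.  The census-level transfer (summing §3 over anchor 294's labels at every codegree) is NOT in this sheet.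

NUMERICS FIRST (owner, file-backed; `gen57/probe28/betti_numerics.py` → `.out`): (B1) (B-W) evaluated LITERALLY as typed (ℕ-truncated
subtraction) for `p ≤ 13`, all `0 < c < p`, `m ≤ 200`, every `T` under the four hypotheses — 0 violations; sharpness: `T + c ≤ m` and
`p − c ≤ T` relaxed by one fail at every boundary instance, the two halving hypotheses are not sharp by one; (B2) ACTUAL ranks over
`GF(p)` (`p ≤ 7`, `m ≤ 9`): `β = S_p(m,T) − S_p(m,T+c) ≥ 0` throughout the closed window; (B3) ACTUAL matrices: the product vanishes mod `p`
and `dim leftker − dim rowspace = S_p(m,T) − S_p(m,T+c)` in the window; (B4) the three-case law (0 below, section difference in the window,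
0 beyond) on the closed ranks for `p ≤ 13`, `m ≤ 160`, all `T` — 0 violations; (L1) §3 evaluated LITERALLY as typed (every branch, ℕ-truncation)
for `p ≤ 13`, `0 < c < p`, all `m ≤ 60`, all `t ≤ m + 2` — 0 violations; (L2) ACTUAL block homology over `GF(p)`, `m ≤ 6`: `C(m,t) − rank − rank =
[window]·(S_p(m,t) − S_p(m,t+c))` — 0 violations.  Instance counts are in the READY line.
-/

set_option linter.dupNamespace false
set_option autoImplicit false

namespace Summit.HodgeConjecture.HodgeConjecture.HodgeLocus.Census.InclusionRankBetti

open Summit.HodgeConjecture.HodgeConjecture.HodgeLocus.Census.UnitColumnRankDrop (wilson_sum_add_eq)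
open Summit.HodgeConjecture.HodgeConjecture.HodgeLocus.Census.UnitColumnRankDropExact (wilson_sum_add_wilson_sum_eq)

/-! ## §1 (B-W): two Wilson sums and two `p`-sections of the binomial row -/

/-- **(B-W)** for a prime `p > c ≥ 1`, `T + c ≤ m`, `p − c ≤ T`, `2(T − (p−c)) ≤ m` and `2(m − (T+c)) ≤ m`:
`Σ_{i ≤ m−T−c} [p ∤ C(m−T−i, m−T−c−i)] (C(m,i) − C(m,i−1)) + Σ_{i ≤ T−p+c} [p ∤ C(T−i, T−p+c−i)] (C(m,i) − C(m,i−1))`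
`  + Σ_{b<T/p} C(m, T−(b+1)p) + Σ_{b<(m−T)/p} C(m, T+(b+1)p) = Σ_{b<(T+c)/p} C(m, T+c−(b+1)p) + C(m, T+c) + Σ_{b<(m−T−c)/p} C(m, T+c+(b+1)p)`,
i.e. `rank_p W_{m−T−c,m−T}(m) + rank_p W_{T−p+c,T}(m) + (S_p(m,T) − C(m,T)) = S_p(m,T+c)` in Wilson's closed form.  Anchor 304's (FY) writes
each Wilson sum as `C(m,t) + Σ_{b≥1} C(m, t−bp) − Σ_{b≥1} C(m, t+s−bp)`; at `t = m−T−c` the symmetry `C(m, m−y) = C(m, y)` turns these into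
the pieces of the two sections ABOVE `T` and `T+c`, at `t = T−p+c` they are the pieces BELOW (`Σ_{b≥1} C(m, T+c−bp) = C(m, T−p+c) + Σ_{b≥1}
C(m, T−p+c−bp)`), and everything cancels but `C(m,T)`. -/
theorem wilson_sum_add_wilson_sum_add_eq {p c : ℕ} (hp : p.Prime) (hc : 0 < c) (hcp : c < p) (m T : ℕ) (hTc : T + c ≤ m)
    (hpT : p - c ≤ T) (hlo : 2 * (T - (p - c)) ≤ m) (hhi : 2 * (m - (T + c)) ≤ m) :
    (∑ i ∈ Finset.range (m - (T + c) + 1),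
        if p ∣ (m - T - i).choose (m - (T + c) - i) then 0 else (m.choose i - if i = 0 then 0 else m.choose (i - 1))) +
      (∑ i ∈ Finset.range (T - (p - c) + 1),
        if p ∣ (T - i).choose (T - (p - c) - i) then 0 else (m.choose i - if i = 0 then 0 else m.choose (i - 1))) +
      (∑ b ∈ Finset.range (T / p), m.choose (T - (b + 1) * p)) + ∑ b ∈ Finset.range ((m - T) / p), m.choose (T + (b + 1) * p) =
    (∑ b ∈ Finset.range ((T + c) / p), m.choose (T + c - (b + 1) * p)) + m.choose (T + c) +
      ∑ b ∈ Finset.range ((m - (T + c)) / p), m.choose (T + c + (b + 1) * p) := by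
  have h1 := wilson_sum_add_eq hp hcp m (m - (T + c)) (m - T) (by omega) hhi
  have h2 := wilson_sum_add_eq hp (show p - c < p by omega) m (T - (p - c)) T (by omega) hlo
  rw [show m - (T + c) + c = m - T by omega] at h1
  rw [show T - (p - c) + (p - c) = T by omega] at h2
  have symm : ∀ (X : ℕ), X ≤ m → ∑ b ∈ Finset.range ((m - X) / p), m.choose (m - X - (b + 1) * p) =
      ∑ b ∈ Finset.range ((m - X) / p), m.choose (X + (b + 1) * p) := by
    intro X hX
    refine Finset.sum_congr rfl (fun b hb => ?_)
    rw [Finset.mem_range] at hb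
    have hb' : (b + 1) * p ≤ m - X := (Nat.le_div_iff_mul_le hp.pos).mp hb
    rw [show m - X - (b + 1) * p = m - (X + (b + 1) * p) by omega, Nat.choose_symm (by omega)]
  have s1 := symm T (by omega)
  have s3 := symm (T + c) hTc
  have s2 : m.choose (m - (T + c)) = m.choose (T + c) := Nat.choose_symm hTc
  have key : ∑ b ∈ Finset.range ((T + c) / p), m.choose (T + c - (b + 1) * p) =
      (∑ b ∈ Finset.range ((T - (p - c)) / p), m.choose (T - (p - c) - (b + 1) * p)) + m.choose (T - (p - c)) := by
    rw [show T + c = T - (p - c) + p by omega, Nat.add_div_right _ hp.pos, Finset.sum_range_succ', Nat.zero_add, one_mul,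
      Nat.add_sub_cancel]
    congr 1
    refine Finset.sum_congr rfl (fun b _ => ?_)
    rw [show (b + 1 + 1) * p = (b + 1) * p + p by ring, Nat.add_sub_add_right]
  omega

/-! ## §2 (B-rank), (B-cx), (B-hom): the homology of the inclusion ladder at the first unbalanced spot -/

variable (K : Type*) [Field K] {α : Type*} [Fintype α] [DecidableEq α]

/-- **(B-rank)** over a field of prime characteristic `p > c ≥ 1`, for `T + c ≤ #α`, `p − c ≤ T` and the closed window `2T ≤ #α + (p−c)`,
`#α ≤ 2T + c`:  `rank W_{T,T+c} + rank W_{T−(p−c),T} + Σ_{b<T/p} C(#α, T−(b+1)p) + Σ_{b<(#α−T)/p} C(#α, T+(b+1)p)`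
`= Σ_{b<(T+c)/p} C(#α, T+c−(b+1)p) + C(#α, T+c) + Σ_{b<(#α−T−c)/p} C(#α, T+c+(b+1)p)`, i.e. `rank W_{T,T+c} + rank W_{T−(p−c),T} = C(#α,T) −
(S_p(#α,T) − S_p(#α,T+c))`.  The unbalanced `W_{T,T+c}` has the rank of its balanced complement `W_{#α−T−c,#α−T}` (anchor InclusionRankComplement),
both ranks are then Wilson sums (anchor InclusionRankLift `rank_incl_eq_sum`, whose side conditions are exactly the closed window), and (B-W). -/
theorem rank_incl_add_rank_incl_add_eq (p : ℕ) [CharP K p] (hp : p.Prime) {c : ℕ} (hc : 0 < c) (hcp : c < p) (T : ℕ)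
    (hTc : T + c ≤ Fintype.card α) (hpT : p - c ≤ T) (hlo : 2 * T ≤ Fintype.card α + (p - c)) (hhi : Fintype.card α ≤ 2 * T + c) :
    (Matrix.of fun (S : {S : Finset α // S.card = T}) (U : {S : Finset α // S.card = T + c}) => if S.1 ⊆ U.1 then (1 : K) else 0).rank +
      (Matrix.of fun (S : {S : Finset α // S.card = T - (p - c)}) (U : {S : Finset α // S.card = T}) => if S.1 ⊆ U.1 then (1 : K) else 0).rank +
      (∑ b ∈ Finset.range (T / p), (Fintype.card α).choose (T - (b + 1) * p)) +
      ∑ b ∈ Finset.range ((Fintype.card α - T) / p), (Fintype.card α).choose (T + (b + 1) * p) =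
    (∑ b ∈ Finset.range ((T + c) / p), (Fintype.card α).choose (T + c - (b + 1) * p)) + (Fintype.card α).choose (T + c) +
      ∑ b ∈ Finset.range ((Fintype.card α - (T + c)) / p), (Fintype.card α).choose (T + c + (b + 1) * p) := by
  rw [InclusionRankComplement.rank_incl_eq_rank_incl_compl K T (T + c) (by omega) hTc,
    InclusionRankLift.rank_incl_eq_sum K p (Fintype.card α - (T + c)) (Fintype.card α - T) (by omega) (by omega),
    InclusionRankLift.rank_incl_eq_sum K p (T - (p - c)) T (by omega) (by omega)]
  exact wilson_sum_add_wilson_sum_add_eq hp hc hcp (Fintype.card α) T hTc hpT (by omega) (by omega)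

/-- **(B-cx)** over a field of prime characteristic `p > c ≥ 1` and for `p − c ≤ T` (no window needed): the row space of `W_{T−(p−c),T}` lies
in the left kernel of `W_{T,T+c}` — `y · W_{T−(p−c),T} · W_{T,T+c} = C(p, p−c) · y · W_{T−(p−c),T+c} = 0` (anchor InclusionRankFiltration
`incl_mul_incl`, `p ∣ C(p, p−c)`).  The inclusion ladder is a complex in characteristic `p`. -/
theorem range_vecMulLinear_le_ker (p : ℕ) [CharP K p] (hp : p.Prime) {c : ℕ} (hc : 0 < c) (hcp : c < p) (T : ℕ) (hpT : p - c ≤ T) :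
    LinearMap.range (Matrix.vecMulLinear
      (Matrix.of fun (S : {S : Finset α // S.card = T - (p - c)}) (U : {S : Finset α // S.card = T}) => if S.1 ⊆ U.1 then (1 : K) else 0)) ≤
    LinearMap.ker (Matrix.vecMulLinear
      (Matrix.of fun (S : {S : Finset α // S.card = T}) (U : {S : Finset α // S.card = T + c}) => if S.1 ⊆ U.1 then (1 : K) else 0)) := by
  rintro _ ⟨y, rfl⟩
  rw [LinearMap.mem_ker, Matrix.vecMulLinear_apply, Matrix.vecMulLinear_apply, Matrix.vecMul_vecMul,
    InclusionRankFiltration.incl_mul_incl K (T - (p - c)) T (T + c) (by omega),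
    show T + c - (T - (p - c)) = p by omega, show T - (T - (p - c)) = p - c by omega,
    (CharP.cast_eq_zero_iff K p _).mpr (hp.dvd_choose_self (by omega) (by omega)), zero_smul, Matrix.vecMul_zero]

/-- **(B-hom) THE MIDDLE TERM.**  Over a field of prime characteristic `p > c ≥ 1`, for `T + c ≤ #α`, `p − c ≤ T` and the closed window
`2T ≤ #α + (p−c)`, `#α ≤ 2T + c`:  `dim leftker W_{T,T+c} + S_p(#α, T+c) = dim rowspace W_{T−(p−c),T} + S_p(#α, T)` with both sections in
pieces, i.e. the homology `leftker W_{T,T+c} / rowspace W_{T−(p−c),T}` of the ladder at its first unbalanced spot ((B-cx): it is a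
subquotient) has dimension `S_p(#α,T) − S_p(#α,T+c) = Σ_{y ≡ T (p)} C(#α,y) − Σ_{y ≡ T+c (p)} C(#α,y) ≥ 0`.  At a balanced spot (`2T + c ≤ #α`,
PROBE 27 (EX-ker)) the homology is `0`; for the trivial group this is the value in Mnukhin–Siemons, JCTA 74 (1996), Thm 5.3 (`r* = T`,
`q* = T + c`), re-proved here from Wilson's formula by rank–nullity and (B-rank). -/
theorem finrank_ker_add_eq (p : ℕ) [CharP K p] (hp : p.Prime) {c : ℕ} (hc : 0 < c) (hcp : c < p) (T : ℕ)
    (hTc : T + c ≤ Fintype.card α) (hpT : p - c ≤ T) (hlo : 2 * T ≤ Fintype.card α + (p - c)) (hhi : Fintype.card α ≤ 2 * T + c) :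
    Module.finrank K (LinearMap.ker (Matrix.vecMulLinear
      (Matrix.of fun (S : {S : Finset α // S.card = T}) (U : {S : Finset α // S.card = T + c}) => if S.1 ⊆ U.1 then (1 : K) else 0))) +
      ((∑ b ∈ Finset.range ((T + c) / p), (Fintype.card α).choose (T + c - (b + 1) * p)) + (Fintype.card α).choose (T + c) +
        ∑ b ∈ Finset.range ((Fintype.card α - (T + c)) / p), (Fintype.card α).choose (T + c + (b + 1) * p)) =
    Module.finrank K (LinearMap.range (Matrix.vecMulLinear
      (Matrix.of fun (S : {S : Finset α // S.card = T - (p - c)}) (U : {S : Finset α // S.card = T}) => if S.1 ⊆ U.1 then (1 : K) else 0))) +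
      ((∑ b ∈ Finset.range (T / p), (Fintype.card α).choose (T - (b + 1) * p)) + (Fintype.card α).choose T +
        ∑ b ∈ Finset.range ((Fintype.card α - T) / p), (Fintype.card α).choose (T + (b + 1) * p)) := by
  have hA : ∀ (a b : ℕ) (A : Matrix {S : Finset α // S.card = a} {S : Finset α // S.card = b} K),
      Module.finrank K (LinearMap.range (Matrix.vecMulLinear A)) = A.rank := fun a b A => by
    rw [← Matrix.mulVecLin_transpose, ← Matrix.rank_transpose]
    rfl
  have h1 := LinearMap.finrank_range_add_finrank_ker (Matrix.vecMulLinear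
    (Matrix.of fun (S : {S : Finset α // S.card = T}) (U : {S : Finset α // S.card = T + c}) => if S.1 ⊆ U.1 then (1 : K) else 0))
  rw [Module.finrank_fintype_fun_eq_card, Fintype.card_finset_len, hA] at h1
  rw [hA]
  have h2 := rank_incl_add_rank_incl_add_eq K p hp hc hcp T hTc hpT hlo hhi
  omega

/-! ## §3 the three-case law of one block (every `m`, `t`) -/

/-- reflection of a `p`-section tail: for `X ≤ m`, `Σ_{b<(m−X)/p} C(m, m−X−(b+1)p) = Σ_{b<(m−X)/p} C(m, X+(b+1)p)` (`C(m, m−y) = C(m, y)`). -/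
theorem sum_choose_reflect {p : ℕ} (hp : 0 < p) (m X : ℕ) (hX : X ≤ m) :
    ∑ b ∈ Finset.range ((m - X) / p), m.choose (m - X - (b + 1) * p) = ∑ b ∈ Finset.range ((m - X) / p), m.choose (X + (b + 1) * p) := by
  refine Finset.sum_congr rfl (fun b hb => ?_)
  rw [Finset.mem_range] at hb
  have hb' : (b + 1) * p ≤ m - X := (Nat.le_div_iff_mul_le hp).mp hb
  rw [show m - X - (b + 1) * p = m - (X + (b + 1) * p) by omega, Nat.choose_symm (by omega)]

/-- shift of a `p`-section tail by one period: `Σ_{b<(X+p)/p} C(m, X+p−(b+1)p) = Σ_{b<X/p} C(m, X−(b+1)p) + C(m, X)`. -/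
theorem sum_choose_shift {p : ℕ} (hp : 0 < p) (m X : ℕ) :
    ∑ b ∈ Finset.range ((X + p) / p), m.choose (X + p - (b + 1) * p) = (∑ b ∈ Finset.range (X / p), m.choose (X - (b + 1) * p)) + m.choose X := by
  rw [Nat.add_div_right _ hp, Finset.sum_range_succ', Nat.zero_add, one_mul, Nat.add_sub_cancel]
  congr 1
  refine Finset.sum_congr rfl (fun b _ => ?_)
  rw [show (b + 1 + 1) * p = (b + 1) * p + p by ring, Nat.add_sub_add_right]

/-- **(BLOCK LAW) the three-case law of one block.**  For a prime `p > c ≥ 1` and ANY `m, t`: with `OUT =` anchor LevelsWilson's branch value of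
the block `(t → t+c)` on `m` points (`0` if `m < t + c`; Wilson's sum below the middle; the complement's Wilson sum above it), `IN =` the same for
the block `(t−(p−c) → t)` when `p − c ≤ t` (else `0`), and the WINDOW `2t ≤ m + (p−c) ∧ m < 2t + c`:
`OUT + IN + [window]·S_p(m,t) = C(m,t) + [window]·S_p(m,t+c)` with both `p`-sections `S_p(m,x) = Σ_{y ≤ m, y ≡ x (p)} C(m,y)` in pieces — i.e. the
block's homology `C(m,t) − OUT − IN` is `0` off the window (PROBE 27 (EX-W), twice: below it and, with `c ↔ p − c` at the complement, beyond it) and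
`S_p(m,t) − S_p(m,t+c)` on it (§1 (B-W) and its degenerate corners `t < p − c` (no in-block) and `m < t + c` (no columns), all from anchor
304's (FY)). -/
theorem block_law {p c : ℕ} (hp : p.Prime) (hc : 0 < c) (hcp : c < p) (m t : ℕ) :
    (if m < t + c then 0
      else if t + (t + c) ≤ m then
        ∑ i ∈ Finset.range (t + 1),
          (if p ∣ (t + c - i).choose (t - i) then 0 else (m.choose i - if i = 0 then 0 else m.choose (i - 1)))
      else
        ∑ i ∈ Finset.range (m - (t + c) + 1),
          (if p ∣ (m - t - i).choose (m - (t + c) - i) then 0 else (m.choose i - if i = 0 then 0 else m.choose (i - 1)))) +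
      (if p - c ≤ t then
        (if m < t - (p - c) + (p - c) then 0
          else if t - (p - c) + (t - (p - c) + (p - c)) ≤ m then
            ∑ i ∈ Finset.range (t - (p - c) + 1),
              (if p ∣ (t - (p - c) + (p - c) - i).choose (t - (p - c) - i) then 0
               else (m.choose i - if i = 0 then 0 else m.choose (i - 1)))
          else
            ∑ i ∈ Finset.range (m - (t - (p - c) + (p - c)) + 1),
              (if p ∣ (m - (t - (p - c)) - i).choose (m - (t - (p - c) + (p - c)) - i) then 0
               else (m.choose i - if i = 0 then 0 else m.choose (i - 1))))
        else 0) +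
      (if 2 * t ≤ m + (p - c) ∧ m < 2 * t + c then
        (∑ b ∈ Finset.range (t / p), m.choose (t - (b + 1) * p)) + m.choose t + ∑ b ∈ Finset.range ((m - t) / p), m.choose (t + (b + 1) * p)
        else 0) =
    m.choose t +
      (if 2 * t ≤ m + (p - c) ∧ m < 2 * t + c then
        (∑ b ∈ Finset.range ((t + c) / p), m.choose (t + c - (b + 1) * p)) + m.choose (t + c) +
          ∑ b ∈ Finset.range ((m - (t + c)) / p), m.choose (t + c + (b + 1) * p)
        else 0) := by
  by_cases hcol : m < t + c
  · -- no columns: OUT = 0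
    rw [if_pos hcol]
    have hC : m.choose (t + c) = 0 := Nat.choose_eq_zero_of_lt hcol
    have hup' : ∑ b ∈ Finset.range ((m - (t + c)) / p), m.choose (t + c + (b + 1) * p) = 0 := by
      rw [show m - (t + c) = 0 by omega, Nat.zero_div, Finset.range_zero, Finset.sum_empty]
    by_cases hin : p - c ≤ t
    · rw [if_pos hin]
      by_cases htm : m < t
      · -- no rows either
        have hw : ¬ (2 * t ≤ m + (p - c) ∧ m < 2 * t + c) := by omega
        rw [if_pos (show m < t - (p - c) + (p - c) by omega), if_neg hw, if_neg hw, Nat.choose_eq_zero_of_lt htm]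
      · rw [if_neg (show ¬ m < t - (p - c) + (p - c) by omega)]
        have hup : ∑ b ∈ Finset.range ((m - t) / p), m.choose (t + (b + 1) * p) = 0 := by
          rw [Nat.div_eq_of_lt (by omega : m - t < p), Finset.range_zero, Finset.sum_empty]
        by_cases hbi : t - (p - c) + (t - (p - c) + (p - c)) ≤ m
        · -- window, in-block balanced: (FY) for the in-block and the shift
          have hw : 2 * t ≤ m + (p - c) ∧ m < 2 * t + c := ⟨by omega, by omega⟩
          rw [if_pos hbi, if_pos hw, if_pos hw, hC, hup, hup']
          have h2 := wilson_sum_add_eq hp (show p - c < p by omega) m (t - (p - c)) (t - (p - c) + (p - c)) rfl (by omega)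
          have e1 : t - (p - c) + (p - c) = t := by omega
          rw [e1] at h2
          have key := sum_choose_shift hp.pos m (t - (p - c))
          rw [show t - (p - c) + p = t + c by omega] at key
          rw [e1]
          omega
        · -- beyond the window, in-block by its complement: (FY) for the complement, which is all of C(m, m−t) = C(m,t)
          have hw : ¬ (2 * t ≤ m + (p - c) ∧ m < 2 * t + c) := by omega
          rw [if_neg hbi, if_neg hw, if_neg hw, Nat.add_zero, Nat.add_zero, Nat.zero_add]
          have e1 : t - (p - c) + (p - c) = t := by omega
          have e2 : m - (t - (p - c)) = m - t + (p - c) := by omega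
          rw [e1, e2]
          have h2 := wilson_sum_add_eq hp (show p - c < p by omega) m (m - t) (m - t + (p - c)) rfl (by omega)
          rw [Nat.div_eq_of_lt (by omega : m - t + (p - c) < p), Nat.div_eq_of_lt (by omega : m - t < p), Finset.range_zero,
            Finset.sum_empty, Finset.sum_empty, Nat.add_zero, Nat.add_zero, Nat.choose_symm (by omega : t ≤ m)] at h2
          exact h2
    · -- no in-block
      rw [if_neg hin]
      have hlow : ∑ b ∈ Finset.range (t / p), m.choose (t - (b + 1) * p) = 0 := by
        rw [Nat.div_eq_of_lt (by omega : t < p), Finset.range_zero, Finset.sum_empty]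
      have hlow' : ∑ b ∈ Finset.range ((t + c) / p), m.choose (t + c - (b + 1) * p) = 0 := by
        rw [Nat.div_eq_of_lt (by omega : t + c < p), Finset.range_zero, Finset.sum_empty]
      by_cases htm : m < t
      · have hup : ∑ b ∈ Finset.range ((m - t) / p), m.choose (t + (b + 1) * p) = 0 := by
          rw [show m - t = 0 by omega, Nat.zero_div, Finset.range_zero, Finset.sum_empty]
        rw [hlow, hlow', hup, hup', hC, Nat.choose_eq_zero_of_lt htm]
      · have hup : ∑ b ∈ Finset.range ((m - t) / p), m.choose (t + (b + 1) * p) = 0 := by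
          rw [Nat.div_eq_of_lt (by omega : m - t < p), Finset.range_zero, Finset.sum_empty]
        have hw : 2 * t ≤ m + (p - c) ∧ m < 2 * t + c := ⟨by omega, by omega⟩
        rw [if_pos hw, if_pos hw, hlow, hlow', hup, hup', hC]
        omega
  · -- columns exist
    rw [if_neg hcol]
    by_cases hbal : t + (t + c) ≤ m
    · -- balanced out-block: no window
      have hw : ¬ (2 * t ≤ m + (p - c) ∧ m < 2 * t + c) := by omega
      rw [if_pos hbal, if_neg hw, if_neg hw, Nat.add_zero, Nat.add_zero]
      by_cases hin : p - c ≤ t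
      · -- PROBE 27 (EX-W)
        rw [if_pos hin, if_neg (show ¬ m < t - (p - c) + (p - c) by omega),
          if_pos (show t - (p - c) + (t - (p - c) + (p - c)) ≤ m by omega)]
        obtain ⟨t, rfl⟩ : ∃ t₀, t = t₀ + (p - c) := ⟨t - (p - c), by omega⟩
        rw [Nat.add_sub_cancel]
        exact wilson_sum_add_wilson_sum_eq hp hc hcp m t (by omega)
      · -- no in-block: (FY) with both tails empty
        rw [if_neg hin, Nat.add_zero]
        have h1 := wilson_sum_add_eq hp hcp m t (t + c) rfl (by omega)
        rw [Nat.div_eq_of_lt (by omega : t + c < p), Nat.div_eq_of_lt (by omega : t < p), Finset.range_zero, Finset.sum_empty,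
          Finset.sum_empty, Nat.add_zero, Nat.add_zero] at h1
        exact h1
    · -- unbalanced out-block, by its complement
      rw [if_neg hbal]
      by_cases hin : p - c ≤ t
      · rw [if_pos hin, if_neg (show ¬ m < t - (p - c) + (p - c) by omega)]
        by_cases hbi : t - (p - c) + (t - (p - c) + (p - c)) ≤ m
        · -- THE WINDOW: PROBE 28 (B-W)
          have hw : 2 * t ≤ m + (p - c) ∧ m < 2 * t + c := ⟨by omega, by omega⟩
          rw [if_pos hbi, if_pos hw, if_pos hw]
          have e1 : t - (p - c) + (p - c) = t := by omega
          rw [e1]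
          have h := wilson_sum_add_wilson_sum_add_eq hp hc hcp m t (by omega) hin (by omega) (by omega)
          omega
        · -- beyond the window: PROBE 27 (EX-W) for the complements, `c ↔ p − c`
          have hw : ¬ (2 * t ≤ m + (p - c) ∧ m < 2 * t + c) := by omega
          rw [if_neg hbi, if_neg hw, if_neg hw, Nat.add_zero, Nat.add_zero]
          have e1 : t - (p - c) + (p - c) = t := by omega
          have e2 : m - (t - (p - c)) = m - (t + c) + c + (p - c) := by omega
          have e3 : m - t = m - (t + c) + c := by omega
          rw [e1, e2, e3]
          have h := wilson_sum_add_wilson_sum_eq hp (show 0 < p - c by omega) (show p - c < p by omega) m (m - (t + c)) (by omega)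
          have e4 : m.choose (m - (t + c) + c) = m.choose t := by
            rw [show m - (t + c) + c = m - t by omega, Nat.choose_symm (by omega)]
          rw [show p - (p - c) = c by omega, e4] at h
          rw [add_comm]
          exact h
      · -- window, no in-block: (FY) for the complement and two reflections
        have hw : 2 * t ≤ m + (p - c) ∧ m < 2 * t + c := ⟨by omega, by omega⟩
        rw [if_neg hin, Nat.add_zero, if_pos hw, if_pos hw]
        have hlow : ∑ b ∈ Finset.range (t / p), m.choose (t - (b + 1) * p) = 0 := by
          rw [Nat.div_eq_of_lt (by omega : t < p), Finset.range_zero, Finset.sum_empty]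
        have hlow' : ∑ b ∈ Finset.range ((t + c) / p), m.choose (t + c - (b + 1) * p) = 0 := by
          rw [Nat.div_eq_of_lt (by omega : t + c < p), Finset.range_zero, Finset.sum_empty]
        rw [hlow, hlow']
        have h1 := wilson_sum_add_eq hp hcp m (m - (t + c)) (m - t) (by omega) (by omega)
        rw [show m - (t + c) + c = m - t by omega, sum_choose_reflect hp.pos m t (by omega), sum_choose_reflect hp.pos m (t + c) (by omega),
          Nat.choose_symm (by omega : t + c ≤ m)] at h1
        omega

end Summit.HodgeConjecture.HodgeConjecture.HodgeLocus.Census.InclusionRankBetti
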